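import Mathlib
import Summits.Ventures.HodgeRepro2.T5AdicCompletionConductor

/-!
# T5UnramifiedCharacter — unramified characters are determined by a uniformiser; at an inert
place an unramified character trivial on the base field is trivial (E9 of N4.1)

Blind cell pub-hodge-repro2, seat p4 (Tier-5 Lean support, annex growth only).
Declaration per README §8(d): uses an L-value-free non-vanishing device: NO.

Row E9 of route/T5-N4.1-route-1.md («the three forcing facts at an inert unramified place»,
[A], elementary: `E_v^× = ϖ_v^ℤ × O_{E_v}^×`) contains two statements about characters:
«an unramified character of `E_v^×` trivial on `F_v^×` is trivial (`ϖ_v ∈ F_v`)» and «an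
unramified character with restriction `ε_{E_v/F_v}` to `F_v^×` is the unramified quadratic
character `ε′_v`». Both reduce to: an UNRAMIFIED character (trivial on the units of valuation `1`)
of a `Valued L ℤᵐ⁰` field is determined by its value at a uniformiser, because every non-zero `x`
is `u · ϖ ^ n` with `v u = 1`, `n = -log (v x)`.

* §1 (`L` a `Valued L ℤᵐ⁰` field, `χ : Lˣ →* M` into a commutative group): the decomposition
  `x = u * ϖ ^ n` (`exists_val_eq_one_mul_zpow`), `χ x = χ ϖ ^ n` (`apply_eq_zpow`),
  `ext_of_apply_uniformizer_eq` (two unramified characters agreeing at a uniformiser agree),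
  `eq_one_of_apply_uniformizer_eq_one`.
* §2 (the concrete inert pair of Mathlib's number-field completions: `ϖ ∈ O_Kv` stays a
  uniformiser of `O_Lw`): an unramified character of `Lwˣ` trivial on the image of `Kvˣ` is trivial
  (`eq_one_of_unramified_of_trivial_on_base`), and two unramified characters with the same
  restriction to `Kvˣ` agree (`ext_of_unramified_of_restrict_eq`).

Nothing here is asserted about the Tier-5 datum.
-/

namespace Summit.Ventures.HodgeRepro2.T5UnramifiedCharacter

open IsDedekindDomain HeightOneSpectrum NumberField WithZero
open scoped WithZero

/-! ## §1 Unramified characters of a `Valued L ℤᵐ⁰` field -/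

section General

variable {L : Type*} [Field L] [Valued L ℤᵐ⁰]

/-- Every non-zero `x` is `u * ϖ ^ n` with `v u = 1` and `n = -log (v x)`, for a uniformiser `ϖ`
(`v ϖ = exp (-1)`). -/
theorem exists_val_eq_one_mul_zpow {ϖ : L} (hϖ : Valued.v ϖ = exp (-1)) {x : L} (hx : x ≠ 0) :
    ∃ u : L, Valued.v u = 1 ∧ x = u * ϖ ^ (-(log (Valued.v x))) := by
  have hϖ0 : ϖ ≠ 0 := by rintro rfl; rw [map_zero] at hϖ; exact exp_ne_zero hϖ.symm
  have hvx : Valued.v x ≠ 0 := (Valuation.ne_zero_iff _).mpr hx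
  refine ⟨x * ϖ ^ (log (Valued.v x)), ?_, ?_⟩
  · rw [map_mul, map_zpow₀, hϖ, ← exp_zsmul, ← exp_log hvx, log_exp, ← exp_add]
    simp
  · rw [mul_assoc, ← zpow_add₀ hϖ0, add_neg_cancel, zpow_zero, mul_one]

variable {M : Type*} [CommGroup M]

/-- An unramified character (trivial on the units of valuation `1`) satisfies
`χ x = χ ϖ ^ (-log (v x))` for a uniformiser `ϖ`. -/
theorem apply_eq_zpow (χ : Lˣ →* M) (hχ : ∀ u : Lˣ, Valued.v (u : L) = 1 → χ u = 1)
    {ϖ : Lˣ} (hϖ : Valued.v (ϖ : L) = exp (-1)) (x : Lˣ) :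
    χ x = χ ϖ ^ (-(log (Valued.v (x : L)))) := by
  obtain ⟨u, hu, hxu⟩ := exists_val_eq_one_mul_zpow hϖ x.ne_zero
  have hu0 : u ≠ 0 := by rintro rfl; rw [map_zero] at hu; exact zero_ne_one hu
  have hxu' : x = Units.mk0 u hu0 * ϖ ^ (-(log (Valued.v (x : L)))) := by
    ext; simpa using hxu
  have key : χ x = χ (Units.mk0 u hu0) * χ ϖ ^ (-(log (Valued.v (x : L)))) := by
    rw [← map_zpow, ← map_mul, ← hxu']
  rw [key, hχ (Units.mk0 u hu0) (by simpa using hu), one_mul]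

/-- Two unramified characters agreeing at a uniformiser agree everywhere. -/
theorem ext_of_apply_uniformizer_eq (χ₁ χ₂ : Lˣ →* M)
    (h₁ : ∀ u : Lˣ, Valued.v (u : L) = 1 → χ₁ u = 1)
    (h₂ : ∀ u : Lˣ, Valued.v (u : L) = 1 → χ₂ u = 1)
    {ϖ : Lˣ} (hϖ : Valued.v (ϖ : L) = exp (-1)) (h : χ₁ ϖ = χ₂ ϖ) : χ₁ = χ₂ := by
  ext x
  rw [apply_eq_zpow χ₁ h₁ hϖ x, apply_eq_zpow χ₂ h₂ hϖ x, h]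

/-- An unramified character trivial at a uniformiser is trivial. -/
theorem eq_one_of_apply_uniformizer_eq_one (χ : Lˣ →* M)
    (hχ : ∀ u : Lˣ, Valued.v (u : L) = 1 → χ u = 1)
    {ϖ : Lˣ} (hϖ : Valued.v (ϖ : L) = exp (-1)) (h : χ ϖ = 1) : χ = 1 :=
  ext_of_apply_uniformizer_eq χ 1 hχ (fun _ _ => rfl) hϖ (by simpa using h)

end General

/-! ## §2 The concrete inert pair -/

section Concrete

variable {K : Type*} [Field K] [NumberField K] (v : HeightOneSpectrum (𝓞 K))
variable {L : Type*} [Field L] [NumberField L] (w : HeightOneSpectrum (𝓞 L))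
variable [Algebra (v.adicCompletion K) (w.adicCompletion L)]
  [ContinuousSMul (v.adicCompletion K) (w.adicCompletion L)]
variable {M : Type*} [CommGroup M]

/-- The image in `Lwˣ` of a unit of `Kv`. -/
noncomputable abbrev baseUnits : (v.adicCompletion K)ˣ →* (w.adicCompletion L)ˣ :=
  Units.map (algebraMap (v.adicCompletion K) (w.adicCompletion L) : (v.adicCompletion K) →* _)

/-- A uniformiser `ϖ` of `O_Kv` that stays irreducible in `O_Lw` has `w (algebraMap ϖ) = exp (-1)`
(p395990's `irreducible_iff_val_eq_exp_neg_one`). -/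
theorem val_algebraMap_eq_exp_neg_one {ϖ : v.adicCompletionIntegers K}
    (hϖ' : Irreducible (algebraMap (v.adicCompletionIntegers K) (w.adicCompletionIntegers L) ϖ)) :
    Valued.v (algebraMap (v.adicCompletion K) (w.adicCompletion L) (ϖ : v.adicCompletion K)) =
      exp (-1) := by
  have := (T5AdicCompletionConductor.irreducible_iff_val_eq_exp_neg_one w _).mp hϖ'
  rwa [T5ContinuousValuationExtension.coe_algebraMap_adicCompletionIntegers] at this

/-- E9 (second forcing fact) ON THE CONCRETE INERT PAIR: an unramified character of `Lwˣ`
(trivial on the units of valuation `1`) that is trivial on the image of `Kvˣ` is trivial — the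
uniformiser `ϖ` of `Kv` is a uniformiser of `Lw`. -/
theorem eq_one_of_unramified_of_trivial_on_base {ϖ : v.adicCompletionIntegers K} (hϖ : Irreducible ϖ)
    (hϖ' : Irreducible (algebraMap (v.adicCompletionIntegers K) (w.adicCompletionIntegers L) ϖ))
    (χ : (w.adicCompletion L)ˣ →* M)
    (hχ : ∀ u : (w.adicCompletion L)ˣ, Valued.v (u : w.adicCompletion L) = 1 → χ u = 1)
    (hK : ∀ y : (v.adicCompletion K)ˣ, χ (baseUnits v w y) = 1) : χ = 1 := by
  have hϖ0 : (ϖ : v.adicCompletion K) ≠ 0 := by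
    intro h
    exact hϖ.ne_zero (Subtype.ext h)
  exact eq_one_of_apply_uniformizer_eq_one χ hχ
    (ϖ := baseUnits v w (Units.mk0 _ hϖ0))
    (by simpa using val_algebraMap_eq_exp_neg_one v w hϖ') (hK _)

/-- E9 (third forcing fact) ON THE CONCRETE INERT PAIR: two unramified characters of `Lwˣ` with
the same restriction to the image of `Kvˣ` agree — e.g. the unramified character restricting to
`ε_{E_v/F_v}` is the unramified quadratic character. -/
theorem ext_of_unramified_of_restrict_eq {ϖ : v.adicCompletionIntegers K} (hϖ : Irreducible ϖ)
    (hϖ' : Irreducible (algebraMap (v.adicCompletionIntegers K) (w.adicCompletionIntegers L) ϖ))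
    (χ₁ χ₂ : (w.adicCompletion L)ˣ →* M)
    (h₁ : ∀ u : (w.adicCompletion L)ˣ, Valued.v (u : w.adicCompletion L) = 1 → χ₁ u = 1)
    (h₂ : ∀ u : (w.adicCompletion L)ˣ, Valued.v (u : w.adicCompletion L) = 1 → χ₂ u = 1)
    (hK : ∀ y : (v.adicCompletion K)ˣ, χ₁ (baseUnits v w y) = χ₂ (baseUnits v w y)) :
    χ₁ = χ₂ := by
  have hϖ0 : (ϖ : v.adicCompletion K) ≠ 0 := by
    intro h
    exact hϖ.ne_zero (Subtype.ext h)
  exact ext_of_apply_uniformizer_eq χ₁ χ₂ h₁ h₂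
    (ϖ := baseUnits v w (Units.mk0 _ hϖ0))
    (by simpa using val_algebraMap_eq_exp_neg_one v w hϖ') (hK _)

end Concrete

end Summit.Ventures.HodgeRepro2.T5UnramifiedCharacter
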